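import Mathlib
import HarnessLib
import Summits.QuantumAdvantage.QuantumAdvantage.Theorems.SyndeticDialD
import Literature.Computability.MetaComplexity.ThresholdWindowPolynomial
import Literature.Probability.Moments.HoeffdingCounting

/-!
# SyndeticDial, part E (§7 REV2a — the PERIODIC TWO-CUT STRATEGY by Lucas, the finite WEIGHT-WINDOW CEILING, the binomial tails by Hoeffding) — support for item stmt-QuantumAdvantage-28401

Cell decomp-qadv, seat lens-5 («finite range + asymptotic regime + bridge»), generation 27 — land port of the REV2 additions of
the node «SyndeticDial» (HOME/decomp-qadv-lens-5/g27/SyndeticDial.lean sha256 22d5bb09…, record NODE-g27.md N7; RESIDUAL MODE on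
AbsorptionDial:28401 `MassHiQuasi`).  Parts A–D are IN THE TREE (A p819709 / B p819783 / C p819944 / D `SyndeticDialD`); the
REV2 additions land as parts E (this mechanism's finite form) and F (its asymptotic no-go), each with ONLY the namespace renamed
`Theses.SyndeticDial → Theorems.SyndeticDial`.
PART E: the PERIODIC TWO-CUT STRATEGY `twoCutP c q N₀` (cut 0 reads the MOD₃ class of the weight off its residue mod q — exact
on the weight window [N₀, N₀+q): `pmask_eq_lit`, `ringWinU_twoCutP`, `window_le_winCount_twoCutP`; cuts `twoCutP_zero/one/tail`),
its degree bound `hasDegF_pmask : HasDegF p (pmask c (p^k) N₀) (p^k − 1)` (LUCAS BY NAME: the Literature's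
`Smolensky.modInd_mem_lowDeg` — every indicator [wt ≡ r (mod p^k)] is an 𝔽_p-combination of elementary symmetric polynomials
of degree ≤ p^k − 1 [SrinivasanTripathiVenkitesh2021 §3.2]), the FINITE EXACT ceiling `window_le_of_hardR₂ : HardR₂ p (m+1) 0
(p^k − 1) θ → #{u : N₀ ≤ wt u < N₀ + p^k} ≤ θ·2^(m+1)` (two-tier hardness at top degree p^k − 1 forces a (1 − θ)-fraction of ALL
inputs outside EVERY weight window of width p^k), and the binomial tails `card_wt_upper_le` / `card_wt_lower_le :
#{u : wt u ≷ m/2 ± t} ≤ exp(−2t²/m)·2^m` (HOEFFDING BY NAME: `Literature.Probability.Moments.hoeffding_count_pi`, Hoeffding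
1963 Thm 2 in counting form; `halfSign`, `sum_halfSign`).  Part F draws the asymptotic no-go `not_twoTier_of_qAt_sqrt`.
Tree facts reused by name: part D's `HardR₂`, parts A–C's `winCount`, `RegisterRotation.xorStrat/ringWinU_xorStrat/hasDegF_not`,
`ExactHit.oneCut/lit/ringWinU_oneCut/lit_zero_or_one`, `RigidityLaws.hasDegF_const`, `wtPrefix_zero'`, `Smolensky.modInd/
modInd_mem_lowDeg`, `Moments.hoeffding_count_pi`.  No `sorry`, no new axioms, no instances, no notation.
-/

set_option autoImplicit false
set_option linter.dupNamespace false

namespace Summit.QuantumAdvantage.QuantumAdvantage.Theorems.SyndeticDial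

open Finset
open Summit.QuantumAdvantage.AdviceFreeQNC0
open Literature.Computability.MetaComplexity Literature.Computability.MetaComplexity.Smolensky
open Summit.QuantumAdvantage.QuantumAdvantage.Theorems.LengthDial
open Summit.QuantumAdvantage.QuantumAdvantage.Theorems.AbsorptionDial

/-! ## §7 (REV2a) THE PERIODIC TWO-CUT STRATEGY AND THE FINITE WEIGHT-WINDOW CEILING -/

section PeriodicTwoCut

variable {m : ℕ}

/-- **periodic MOD₃ guess**: read the weight's MOD₃ class off its residue mod `q`, exactly on the weight window
`[N₀, N₀ + q)` (the representative `N₀ + ((wt u mod q) + (q − N₀ mod q)) mod q` of `wt u` in that window). -/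
def pmask (c q N₀ : ℕ) (u : Fin (m + 1) → Bool) : Bool :=
  decide ((c + N₀ + (wt u % q + (q - N₀ % q)) % q) % 3 ≠ 0)

/-- **the periodic two-cut strategy**: cut `0` carries the periodic guess, cut `1` its negation, other cuts silent. -/
def twoCutP (c q N₀ : ℕ) : Fin (m + 1 + 1) → (Fin (m + 1) → Bool) → Bool :=
  RegisterRotation.xorStrat (ExactHit.oneCut 0 (pmask c q N₀)) (ExactHit.oneCut 1 fun u => !pmask c q N₀ u)

/-- on the weight window `[N₀, N₀ + q)` the periodic guess IS cut `0`'s literal. -/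
theorem pmask_eq_lit {c q N₀ : ℕ} (hq : 0 < q) (u : Fin (m + 1) → Bool) (h1 : N₀ ≤ wt u) (h2 : wt u < N₀ + q) :
    pmask c q N₀ u = ExactHit.lit c 0 u := by
  unfold pmask ExactHit.lit walkExp
  rw [wtPrefix_zero', Nat.mod_add_mod]
  have hdiv := Nat.mod_add_div N₀ q
  have hr := Nat.mod_lt N₀ hq
  have ht : wt u + (q - N₀ % q) = (wt u - N₀) + q * (N₀ / q + 1) := by
    rw [Nat.mul_succ]; omega
  rw [ht, Nat.add_mul_mod_self_left, Nat.mod_eq_of_lt (show wt u - N₀ < q by omega),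
    show c + N₀ + (wt u - N₀) = c + 0 + (wt u + 0) by omega]

/-- the periodic two-cut strategy wins at every input whose weight lies in the window. -/
theorem ringWinU_twoCutP {c q N₀ : ℕ} (hq : 0 < q) (u : Fin (m + 1) → Bool) (h1 : N₀ ≤ wt u)
    (h2 : wt u < N₀ + q) : ringWinU c (twoCutP c q N₀) u = true := by
  unfold twoCutP
  rw [RegisterRotation.ringWinU_xorStrat, ExactHit.ringWinU_oneCut, ExactHit.ringWinU_oneCut, pmask_eq_lit hq u h1 h2]
  rcases ExactHit.lit_zero_or_one c u with h0 | h1'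
  · simp [h0]
  · cases h : ExactHit.lit c 0 u
    · simpa [h] using h1'
    · simp [h]

/-- hence it wins at least the window's worth of inputs. -/
theorem window_le_winCount_twoCutP {c q N₀ : ℕ} (hq : 0 < q) :
    (univ.filter fun u : Fin (m + 1) → Bool => N₀ ≤ wt u ∧ wt u < N₀ + q).card
      ≤ winCount (m + 1) c (twoCutP c q N₀) := by
  unfold winCount
  exact Finset.card_le_card fun u hu => by
    rw [Finset.mem_filter] at hu ⊢
    exact ⟨hu.1, ringWinU_twoCutP hq u hu.2.1 hu.2.2⟩

/-- cut `0` of the periodic two-cut strategy is the periodic guess. -/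
theorem twoCutP_zero (c q N₀ : ℕ) : twoCutP (m := m) c q N₀ 0 = pmask c q N₀ := by
  funext u
  unfold twoCutP RegisterRotation.xorStrat ExactHit.oneCut
  simp

/-- cut `1` is its negation. -/
theorem twoCutP_one (c q N₀ : ℕ) : twoCutP (m := m) c q N₀ 1 = fun u => !pmask c q N₀ u := by
  funext u
  unfold twoCutP RegisterRotation.xorStrat ExactHit.oneCut
  have h10 : (1 : Fin (m + 1 + 1)) ≠ 0 := fun h => by
    have := congrArg Fin.val h
    simp at this
  simp [h10]

/-- cuts `≥ 2` are silent. -/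
theorem twoCutP_tail (c q N₀ : ℕ) (g : Fin (m + 1 + 1)) (hg : 2 ≤ g.val) :
    twoCutP (m := m) c q N₀ g = fun _ => false := by
  funext u
  unfold twoCutP RegisterRotation.xorStrat ExactHit.oneCut
  have h0 : g ≠ 0 := fun h => by rw [h] at hg; simp at hg
  have h1 : g ≠ 1 := fun h => by
    rw [h] at hg
    simp at hg
  simp [h0, h1]

variable {p : ℕ} [Fact p.Prime]

/-- **THE PERIODIC GUESS HAS DEGREE `< p^k`** (Lucas, by name: the Literature's `Smolensky.modInd_mem_lowDeg` — every
indicator `[wt ≡ r (mod p^k)]` is an `𝔽_p`-combination of elementary symmetric polynomials of degree `≤ p^k − 1`). -/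
theorem hasDegF_pmask (c k N₀ : ℕ) : HasDegF p (pmask (m := m) c (p ^ k) N₀) (p ^ k - 1) := by
  classical
  set q := p ^ k with hq
  have hq0 : 0 < q := by rw [hq]; exact pow_pos (Nat.Prime.pos (Fact.out)) _
  let G : ℕ → Bool := fun r => decide ((c + N₀ + (r + (q - N₀ % q)) % q) % 3 ≠ 0)
  have hfun : (fun x : Fin (m + 1) → Bool => if pmask c q N₀ x then (1 : ZMod p) else 0)
      = ∑ r ∈ (Finset.range q).filter (fun r => G r = true), modInd (ZMod p) q r := by
    funext x
    rw [Finset.sum_apply]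
    have hwt : Literature.Computability.Complexity.GateFn.numOnes x = wt x := rfl
    have hlt : wt x % q < q := Nat.mod_lt _ hq0
    have hterm : ∀ r ∈ (Finset.range q).filter (fun r => G r = true),
        modInd (ZMod p) q r x = if wt x % q = r then 1 else 0 := by
      intro r hr
      rw [Finset.mem_filter, Finset.mem_range] at hr
      unfold modInd
      rw [hwt, Nat.mod_eq_of_lt hr.1]
    rw [Finset.sum_congr rfl hterm, Finset.sum_ite_eq]
    have hpm : pmask c q N₀ x = G (wt x % q) := rfl
    rw [hpm]
    simp [Finset.mem_filter, Finset.mem_range, hlt]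
  unfold HasDegF
  rw [hfun]
  exact Submodule.sum_mem _ fun r _ => modInd_mem_lowDeg k r le_rfl

/-- **KERNEL FORM OF THE WEIGHT-WINDOW CEILING** (finite and exact): two-tier hardness `θ` with silent interior and top
degree `p^k − 1` forces, at every charge and every window position, a `(1 − θ)`-fraction of ALL inputs to have weight
OUTSIDE the window `[N₀, N₀ + p^k)`.  With the binomial tail bound (Hoeffding: the mass outside the central window of
width `q` is `≤ 2·exp(−q²/(2(m+1)))`, not formalised here) this refutes, given Q, the two-tier statement at top degree
`√m·polylog`, i.e. every absorption bridge of reach `≫ √n·polylog` (module docstring §B'(ii)). -/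
theorem window_le_of_hardR₂ {k N₀ : ℕ} {θ : ℝ} (h : HardR₂ p (m + 1) 0 (p ^ k - 1) θ) (c : ℕ) :
    ((univ.filter fun u : Fin (m + 1) → Bool => N₀ ≤ wt u ∧ wt u < N₀ + p ^ k).card : ℝ) ≤ θ * 2 ^ (m + 1) := by
  have hq0 : 0 < p ^ k := pow_pos (Nat.Prime.pos (Fact.out)) _
  have hY : ∀ g : Fin (m + 1 + 1), g.val < 2 → HasDegF p (twoCutP (m := m) c (p ^ k) N₀ g) (p ^ k - 1) := by
    intro g hg
    have : g = 0 ∨ g = 1 := by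
      obtain ⟨_ | _ | g', hg'⟩ := g
      · exact Or.inl rfl
      · exact Or.inr rfl
      · exact absurd hg (by simp)
    rcases this with rfl | rfl
    · rw [twoCutP_zero]; exact hasDegF_pmask c k N₀
    · rw [twoCutP_one]; exact RegisterRotation.hasDegF_not (hasDegF_pmask c k N₀)
  have hy : ∀ g : Fin (m + 1 + 1), 2 ≤ g.val → HasDegF p (twoCutP (m := m) c (p ^ k) N₀ g) 0 := fun g hg => by
    rw [twoCutP_tail c (p ^ k) N₀ g hg]; exact RigidityLaws.hasDegF_const p false 0
  have hw := h c (twoCutP c (p ^ k) N₀) hy hY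
  exact le_trans (by exact_mod_cast window_le_winCount_twoCutP (c := c) (N₀ := N₀) hq0) hw

/-! #### the binomial tails, by name (Hoeffding) -/

/-- the centred half-indicator fed to Hoeffding's inequality. -/
noncomputable def halfSign (b : Bool) : ℝ := if b then 1 / 2 else -(1 / 2)

/-- `Σ_i halfSign (u i) = wt u − m/2`. -/
theorem sum_halfSign (u : Fin m → Bool) : ∑ i, halfSign (u i) = (wt u : ℝ) - m / 2 := by
  have h1 : ∀ i, halfSign (u i) = (if u i = true then (1 : ℝ) else 0) - 1 / 2 := by
    intro i; unfold halfSign; cases u i <;> norm_num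
  simp_rw [h1]
  rw [Finset.sum_sub_distrib, Finset.sum_boole, Finset.sum_const, Finset.card_univ, Fintype.card_fin,
    nsmul_eq_mul]
  unfold wt
  ring

/-- **upper binomial tail** (Hoeffding 1963 Thm. 2 in counting form, by name: the Literature's
`Literature.Probability.Moments.hoeffding_count_pi`): `#{u : wt u ≥ m/2 + t} ≤ exp(−2t²/m)·2^m`. -/
theorem card_wt_upper_le (hm : 0 < m) {t : ℝ} (ht : 0 ≤ t) :
    ((univ.filter fun u : Fin m → Bool => t ≤ (wt u : ℝ) - m / 2).card : ℝ)
      ≤ Real.exp (-(2 * t ^ 2 / m)) * 2 ^ m := by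
  classical
  have hmR : (0 : ℝ) < m := by exact_mod_cast hm
  have hS : ∑ _i : Fin m, (1 / 2 : ℝ) ^ 2 = m / 4 := by
    rw [Finset.sum_const, Finset.card_univ, Fintype.card_fin, nsmul_eq_mul]; ring
  have h := Literature.Probability.Moments.hoeffding_count_pi (κ := fun _ : Fin m => Bool)
    (fun _ b => halfSign b) (fun _ => (1 / 2 : ℝ))
    (fun _ => by rw [Fintype.sum_bool]; unfold halfSign; norm_num)
    (fun _ b => by unfold halfSign; cases b <;> norm_num) ht (by rw [hS]; positivity)
  have hP : ∏ _i : Fin m, (Fintype.card Bool : ℝ) = 2 ^ m := by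
    rw [Finset.prod_const, Finset.card_univ, Fintype.card_fin, Fintype.card_bool]; norm_num
  have hset : (univ.filter fun u : Fin m → Bool => t ≤ (wt u : ℝ) - m / 2)
      = univ.filter fun y : Fin m → Bool => t ≤ ∑ i, halfSign (y i) := by
    refine Finset.filter_congr fun u _ => ?_
    rw [sum_halfSign]
  rw [hset]
  refine h.trans (le_of_eq ?_)
  rw [hS, hP]
  congr 2
  field_simp
  ring

/-- **lower binomial tail** (Hoeffding, by name): `#{u : wt u ≤ m/2 − t} ≤ exp(−2t²/m)·2^m`. -/
theorem card_wt_lower_le (hm : 0 < m) {t : ℝ} (ht : 0 ≤ t) :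
    ((univ.filter fun u : Fin m → Bool => t ≤ m / 2 - (wt u : ℝ)).card : ℝ)
      ≤ Real.exp (-(2 * t ^ 2 / m)) * 2 ^ m := by
  classical
  have hmR : (0 : ℝ) < m := by exact_mod_cast hm
  have hS : ∑ _i : Fin m, (1 / 2 : ℝ) ^ 2 = m / 4 := by
    rw [Finset.sum_const, Finset.card_univ, Fintype.card_fin, nsmul_eq_mul]; ring
  have h := Literature.Probability.Moments.hoeffding_count_pi (κ := fun _ : Fin m => Bool)
    (fun _ b => -halfSign b) (fun _ => (1 / 2 : ℝ))
    (fun _ => by rw [Fintype.sum_bool]; unfold halfSign; norm_num)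
    (fun _ b => by unfold halfSign; cases b <;> norm_num) ht (by rw [hS]; positivity)
  have hP : ∏ _i : Fin m, (Fintype.card Bool : ℝ) = 2 ^ m := by
    rw [Finset.prod_const, Finset.card_univ, Fintype.card_fin, Fintype.card_bool]; norm_num
  have hset : (univ.filter fun u : Fin m → Bool => t ≤ m / 2 - (wt u : ℝ))
      = univ.filter fun y : Fin m → Bool => t ≤ ∑ i, -halfSign (y i) := by
    refine Finset.filter_congr fun u _ => ?_
    rw [Finset.sum_neg_distrib, sum_halfSign, neg_sub]
  rw [hset]
  refine h.trans (le_of_eq ?_)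
  rw [hS, hP]
  congr 2
  field_simp
  ring

end PeriodicTwoCut

end Summit.QuantumAdvantage.QuantumAdvantage.Theorems.SyndeticDial
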